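import Mathlib
import Literature.Geometry.Symplectic.JHolomorphicMap
import Literature.Geometry.Manifold.LocalDiffeoOnOpen

/-!
# Stub `stub_graphOfPencil` of line `Sketch` (skeleton v6) for crux `TameOrBrodyR4` (stmt-SmoothPoincare4-7826, route SullivanDual)

Far out, the members of a pencil of `J`-planes are holomorphic graphs over a complex coordinate.
Setting: `ℝ⁴ = EuclideanSpace ℝ (Fin 4)` with two coordinate maps `P Q : ℝ⁴ →L[ℝ] ℂ`,
`‖x‖² = |P x|² + |Q x|²`, and a family `J x : ℝ⁴ →L[ℝ] ℝ⁴` which is standard where `‖x‖ ≥ R`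
in the sense `P (J x v) = i P v`, `Q (J x v) = i Q v`; a jointly `C^∞` evaluation map
`F : ℂ → ℂ → ℝ⁴` with flat-`J`-holomorphic slices `F b`, each of which crosses every far line
`{P = c}`, `|c| ≥ R`, at exactly one parameter (`hF6`), transversally (`hF6'`).

Conclusion: there is `g : ℂ → ℂ → ℂ` with `g b (P (F b ξ)) = Q (F b ξ)` wherever
`|P (F b ξ)| ≥ R`, jointly `C^∞` on `{R < |c|}` and holomorphic in `c` there.

Proof.
* `g b c := Q (F b (ξ b c))` with `ξ b c` the unique crossing parameter (choice); the graph
  identity is uniqueness in `hF6`.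
* Joint smoothness: the straightening map `Θ (b, ξ) = (b, P (F b ξ))` is `C^∞`, injective on the
  open set `Ω = {R < |P (F b ξ)|}` (uniqueness again) and has a bijective, block-triangular
  derivative there (`GraphOfPencil.bijective_fst_prod`), hence an invertible strict derivative;
  the inverse function theorem on an open set
  (`Literature.Geometry.Manifold.contDiffOn_invFunOn_of_forall_hasStrictFDerivAt_equiv`) makes
  `invFunOn Θ Ω` smooth on `Θ '' Ω ⊇ {R < |c|}`, and `(b, c) ↦ (b, ξ b c)` agrees with it there.
* Holomorphy in `c`: `g b` is real differentiable (slice of the above); differentiating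
  `g b (P (F b ξ)) = Q (F b ξ)` near the crossing parameter gives `E ∘ D = D_Q` for
  `E = d(g b)_c`, `D = P ∘ d(F b)`, `D_Q = Q ∘ d(F b)`; `D` (bijective) and `D_Q` commute with
  `i` because `d(F b)(i ζ) = J d(F b)(ζ)` and `J` is standard at the far point
  (`‖F b ξ‖ ≥ |P (F b ξ)| > R`), so `E` commutes with `i`
  (`GraphOfPencil.map_mul_I_of_comp_eq`) and is complex linear
  (`Literature.Geometry.Symplectic.exists_restrictScalars_eq_of_map_mul_I`,
  `differentiableAt_iff_restrictScalars`).

Sources: J. M. Lee, *Introduction to Smooth Manifolds*, 2nd ed. (2013), Thm. 4.5 (inverse function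
theorem); M. Gromov, Invent. Math. 82 (1985), §2.4.A (pencils of `J`-planes standard at infinity).
No `J`-curve theory is used here: this is calculus.
-/

open scoped ContDiff Topology
open Filter Set Function Literature.Geometry.Symplectic

-- the registered namespace `Summit.SmoothPoincare4.SmoothPoincare4.…` repeats a component
set_option linter.dupNamespace false

noncomputable section

namespace Summit.SmoothPoincare4.SmoothPoincare4.Cruxes.TameOrBrodyR4.Sketch

/-- Local notation for the model space `ℝ⁴ = EuclideanSpace ℝ (Fin 4)`. -/
local notation "E4" => EuclideanSpace ℝ (Fin 4)

namespace GraphOfPencil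

variable {E₁ E₂ G : Type*} [NormedAddCommGroup E₁] [NormedSpace ℝ E₁] [NormedAddCommGroup E₂]
  [NormedSpace ℝ E₂] [NormedAddCommGroup G] [NormedSpace ℝ G]

/-- A block-triangular map `(u, v) ↦ (u, M (u, v))` is bijective as soon as its corner
`v ↦ M (0, v)` is. -/
theorem bijective_fst_prod {M : E₁ × E₂ →L[ℝ] G}
    (hD : Function.Bijective (M.comp (ContinuousLinearMap.inr ℝ E₁ E₂))) :
    Function.Bijective ((ContinuousLinearMap.fst ℝ E₁ E₂).prod M) := by
  have hsplit : ∀ v : E₁ × E₂, M v = M (v.1, 0) + M.comp (ContinuousLinearMap.inr ℝ E₁ E₂) v.2 := by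
    intro v
    rw [ContinuousLinearMap.comp_apply, ContinuousLinearMap.inr_apply, ← map_add]
    simp
  constructor
  · intro v w h
    simp only [ContinuousLinearMap.prod_apply, ContinuousLinearMap.coe_fst', Prod.mk.injEq] at h
    obtain ⟨h1, h2⟩ := h
    rw [hsplit v, hsplit w, h1] at h2
    exact Prod.ext h1 (hD.1 (add_left_cancel h2))
  · rintro ⟨u, c⟩
    obtain ⟨δ, hδ⟩ := hD.2 (c - M (u, 0))
    refine ⟨(u, δ), ?_⟩
    simp only [ContinuousLinearMap.prod_apply, ContinuousLinearMap.coe_fst', Prod.mk.injEq,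
      true_and]
    rw [hsplit, hδ]
    abel

/-- If `E ∘ D = D'` for real-linear maps of `ℂ` with `D` surjective and `D`, `D'` commuting with
multiplication by `i`, then `E` commutes with multiplication by `i`. -/
theorem map_mul_I_of_comp_eq {D D' E : ℂ →L[ℝ] ℂ} (hD : Function.Surjective D)
    (hcomp : ∀ ζ, E (D ζ) = D' ζ) (hDI : ∀ ζ, D (Complex.I * ζ) = Complex.I * D ζ)
    (hD'I : ∀ ζ, D' (Complex.I * ζ) = Complex.I * D' ζ) (u : ℂ) :
    E (Complex.I * u) = Complex.I • E u := by
  obtain ⟨ζ, rfl⟩ := hD u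
  rw [smul_eq_mul, ← hDI, hcomp, hcomp, hD'I]

/-- `|P x| ≤ ‖x‖` when `‖x‖² = |P x|² + |Q x|²`. -/
theorem norm_apply_le_norm {V : Type*} [NormedAddCommGroup V] (P Q : V → ℂ) (x : V)
    (hPQ : ‖x‖ ^ 2 = ‖P x‖ ^ 2 + ‖Q x‖ ^ 2) : ‖P x‖ ≤ ‖x‖ :=
  le_of_pow_le_pow_left₀ two_ne_zero (norm_nonneg x) (by rw [hPQ]; nlinarith [sq_nonneg ‖Q x‖])

end GraphOfPencil

/-- **Stub C2b (far out, the members of a pencil are holomorphic graphs over `P`).** With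
`‖x‖² = |P x|² + |Q x|²` and `J` standard where `‖x‖ ≥ R` in the sense `P ∘ J = i P`, `Q ∘ J = i Q`:
if every member `F b` of a jointly smooth family of flat-`J`-holomorphic maps crosses each far line
`{P = c}`, `|c| ≥ R`, at exactly one parameter and `ξ ↦ P (F b ξ)` has bijective differential
wherever `|P (F b ξ)| ≥ R`, then there is a family `g b c` (`= Q` of the unique point of `F b` over
`c`), jointly `C^∞` on `{R < |c|}` (inverse function theorem on an open set), holomorphic in `c`
there (its real derivative commutes with `i`), with `g b (P (F b ξ)) = Q (F b ξ)` wherever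
`|P (F b ξ)| ≥ R`. -/
theorem stub_graphOfPencil (J : E4 → E4 →L[ℝ] E4) (R : ℝ) (P Q : E4 →L[ℝ] ℂ)
    (hPQ : ∀ x : E4, ‖x‖ ^ 2 = ‖P x‖ ^ 2 + ‖Q x‖ ^ 2)
    (hJP : ∀ x : E4, R ≤ ‖x‖ → ∀ v, P (J x v) = Complex.I * P v)
    (hJQ : ∀ x : E4, R ≤ ‖x‖ → ∀ v, Q (J x v) = Complex.I * Q v)
    (F : ℂ → ℂ → E4) (hF1 : ContDiff ℝ ∞ (fun p : ℂ × ℂ => F p.1 p.2))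
    (hF4 : ∀ b, IsJHolomorphicFlat J (F b))
    (hF6 : ∀ b c : ℂ, R ≤ ‖c‖ → ∃! ξ, P (F b ξ) = c)
    (hF6' : ∀ b ξ : ℂ, R ≤ ‖P (F b ξ)‖ → Function.Bijective (fderiv ℝ (fun ξ => P (F b ξ)) ξ)) :
    ∃ g : ℂ → ℂ → ℂ, ContDiffOn ℝ ∞ (fun p : ℂ × ℂ => g p.1 p.2) {p | R < ‖p.2‖} ∧
      (∀ b, DifferentiableOn ℂ (g b) {c | R < ‖c‖}) ∧
      (∀ b ξ : ℂ, R ≤ ‖P (F b ξ)‖ → g b (P (F b ξ)) = Q (F b ξ)) := by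
  /- 1. the crossing parameter `xi b c` of the member `F b` over the far line `{P = c}` -/
  obtain ⟨xi, hxi⟩ : ∃ xi : ℂ → ℂ → ℂ, ∀ b c, R ≤ ‖c‖ → P (F b (xi b c)) = c := by
    classical
    exact ⟨fun b c => if h : R ≤ ‖c‖ then (hF6 b c h).exists.choose else 0, fun b c h => by
      simp only [dif_pos h]
      exact (hF6 b c h).exists.choose_spec⟩
  -- uniqueness of the crossing parameter
  have huniq : ∀ b ξ ξ' : ℂ, R ≤ ‖P (F b ξ)‖ → P (F b ξ') = P (F b ξ) → ξ' = ξ :=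
    fun b ξ ξ' h h' => (hF6 b _ h).unique h' rfl
  have hxi' : ∀ b ξ : ℂ, R ≤ ‖P (F b ξ)‖ → xi b (P (F b ξ)) = ξ :=
    fun b ξ h => huniq b ξ _ h (hxi b _ h)
  -- smooth slices, far points
  have hFb : ∀ b, ContDiff ℝ ∞ (F b) := fun b => hF1.comp (contDiff_prodMk_right b)
  have hFbd : ∀ b ξ, DifferentiableAt ℝ (F b) ξ := fun b ξ => (hFb b).differentiable (by simp) ξ
  have hfar : ∀ x : E4, R ≤ ‖P x‖ → R ≤ ‖x‖ :=
    fun x hx => hx.trans (GraphOfPencil.norm_apply_le_norm P Q x (hPQ x))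
  /- 2. joint smoothness: inverse function theorem for the straightening map `Θ` on `Ω` -/
  set Θ : ℂ × ℂ → ℂ × ℂ := fun p => (p.1, P (F p.1 p.2)) with hΘ
  set Ω : Set (ℂ × ℂ) := {p | R < ‖P (F p.1 p.2)‖} with hΩ
  have hPΦ : ContDiff ℝ ∞ (fun p : ℂ × ℂ => P (F p.1 p.2)) := P.contDiff.comp hF1
  have hΘs : ContDiff ℝ ∞ Θ := contDiff_fst.prodMk hPΦ
  have hΩo : IsOpen Ω := isOpen_lt continuous_const (continuous_norm.comp hPΦ.continuous)
  have hinj : InjOn Θ Ω := by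
    rintro ⟨b, ξ⟩ hp ⟨b', ξ'⟩ - he
    simp only [hΘ, Prod.mk.injEq] at he
    obtain ⟨rfl, he⟩ := he
    exact Prod.ext rfl (huniq b ξ' ξ (le_of_lt (by simpa [hΩ, he] using hp)) he)
  have hderiv : ∀ p ∈ Ω, ∃ L : (ℂ × ℂ) ≃L[ℝ] (ℂ × ℂ),
      HasStrictFDerivAt Θ (L : (ℂ × ℂ) →L[ℝ] (ℂ × ℂ)) p := by
    rintro ⟨b, ξ⟩ hp
    have hM : HasStrictFDerivAt Θ (fderiv ℝ Θ (b, ξ)) (b, ξ) :=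
      hΘs.contDiffAt.hasStrictFDerivAt (by simp)
    have h1 : fderiv ℝ Θ (b, ξ) =
        (ContinuousLinearMap.fst ℝ ℂ ℂ).prod (fderiv ℝ (fun p : ℂ × ℂ => P (F p.1 p.2)) (b, ξ)) := by
      have := differentiableAt_fst.fderiv_prodMk (hPΦ.differentiable (by simp) (b, ξ))
      rw [fderiv_fst] at this
      exact this
    have h2 : fderiv ℝ (fun ξ => P (F b ξ)) ξ =
        (fderiv ℝ (fun p : ℂ × ℂ => P (F p.1 p.2)) (b, ξ)).comp (ContinuousLinearMap.inr ℝ ℂ ℂ) :=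
      ((hPΦ.differentiable (by simp) (b, ξ)).hasFDerivAt.comp ξ (hasFDerivAt_prodMk_right b ξ)).fderiv
    have hbij : Function.Bijective (fderiv ℝ Θ (b, ξ)) := by
      rw [h1]
      exact GraphOfPencil.bijective_fst_prod (h2 ▸ hF6' b ξ hp.le)
    set L : (ℂ × ℂ) ≃L[ℝ] (ℂ × ℂ) := (LinearEquiv.ofBijective
      ((fderiv ℝ Θ (b, ξ) : (ℂ × ℂ) →L[ℝ] (ℂ × ℂ)) : (ℂ × ℂ) →ₗ[ℝ] (ℂ × ℂ)) hbij).toContinuousLinearEquiv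
      with hL
    have hLe : (L : (ℂ × ℂ) →L[ℝ] (ℂ × ℂ)) = fderiv ℝ Θ (b, ξ) := by
      refine ContinuousLinearMap.ext fun v => ?_
      simp [hL]
    exact ⟨L, hLe ▸ hM⟩
  have hΨ : ContDiffOn ℝ ∞ (invFunOn Θ Ω) (Θ '' Ω) :=
    Literature.Geometry.Manifold.contDiffOn_invFunOn_of_forall_hasStrictFDerivAt_equiv hΩo
      hΘs.contDiffOn (by simp) hinj hderiv
  -- on the far region `{R < |c|}` the inverse is `(b, c) ↦ (b, xi b c)`
  have hfarq : ∀ q : ℂ × ℂ, R < ‖q.2‖ → (q.1, xi q.1 q.2) ∈ Ω ∧ Θ (q.1, xi q.1 q.2) = q := by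
    rintro ⟨b, c⟩ hc
    have h := hxi b c hc.le
    refine ⟨?_, ?_⟩
    · show R < ‖P (F b (xi b c))‖
      rw [h]; exact hc
    · show (b, P (F b (xi b c))) = (b, c)
      rw [h]
  have himage : {q : ℂ × ℂ | R < ‖q.2‖} ⊆ Θ '' Ω :=
    fun q hq => ⟨_, (hfarq q hq).1, (hfarq q hq).2⟩
  have hinv : ∀ q : ℂ × ℂ, R < ‖q.2‖ → invFunOn Θ Ω q = (q.1, xi q.1 q.2) := by
    intro q hq
    have hex : ∃ p ∈ Ω, Θ p = q := ⟨_, (hfarq q hq).1, (hfarq q hq).2⟩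
    exact hinj (invFunOn_mem hex) (hfarq q hq).1 ((invFunOn_eq hex).trans (hfarq q hq).2.symm)
  have hsmooth : ContDiffOn ℝ ∞ (fun p : ℂ × ℂ => Q (F p.1 (xi p.1 p.2))) {p | R < ‖p.2‖} := by
    have : ContDiffOn ℝ ∞ (fun q => Q (F (invFunOn Θ Ω q).1 (invFunOn Θ Ω q).2)) {p | R < ‖p.2‖} :=
      (Q.contDiff.comp hF1).comp_contDiffOn (hΨ.mono himage)
    refine this.congr fun q hq => ?_
    show Q (F q.1 (xi q.1 q.2)) = Q (F (invFunOn Θ Ω q).1 (invFunOn Θ Ω q).2)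
    rw [hinv q hq]
  refine ⟨fun b c => Q (F b (xi b c)), hsmooth, fun b c hc => ?_, fun b ξ h => ?_⟩
  /- 3. holomorphy in `c`: the real derivative commutes with `i` -/
  · show DifferentiableWithinAt ℂ (fun c => Q (F b (xi b c))) {c | R < ‖c‖} c
    have hgd : DifferentiableAt ℝ (fun c => Q (F b (xi b c))) c := by
      have h1 : ContDiffAt ℝ ∞ (fun p : ℂ × ℂ => Q (F p.1 (xi p.1 p.2))) (b, c) :=
        hsmooth.contDiffAt
          ((isOpen_lt continuous_const (continuous_norm.comp continuous_snd)).mem_nhds hc)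
      exact (h1.comp c (contDiff_prodMk_right b).contDiffAt).differentiableAt (by simp)
    refine ((differentiableAt_iff_restrictScalars ℝ hgd).mpr ?_).differentiableWithinAt
    set ξ₀ := xi b c with hξ₀
    have hc0 : P (F b ξ₀) = c := hxi b c hc.le
    have hR0' : R < ‖P (F b ξ₀)‖ := by rw [hc0]; exact hc
    have hx : R ≤ ‖F b ξ₀‖ := hfar _ hR0'.le
    -- `D = P ∘ dF`, `D_Q = Q ∘ dF`
    have hD : HasFDerivAt (fun ξ => P (F b ξ)) (P.comp (fderiv ℝ (F b) ξ₀)) ξ₀ :=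
      P.hasFDerivAt.comp ξ₀ (hFbd b ξ₀).hasFDerivAt
    have hDQ : HasFDerivAt (fun ξ => Q (F b ξ)) (Q.comp (fderiv ℝ (F b) ξ₀)) ξ₀ :=
      Q.hasFDerivAt.comp ξ₀ (hFbd b ξ₀).hasFDerivAt
    -- `E ∘ D = D_Q`: differentiate `g b (P (F b ξ)) = Q (F b ξ)` near `ξ₀`
    have hEv : (fun ξ => Q (F b (xi b (P (F b ξ))))) =ᶠ[𝓝 ξ₀] fun ξ => Q (F b ξ) := by
      have ho : IsOpen {ξ | R < ‖P (F b ξ)‖} :=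
        isOpen_lt continuous_const (continuous_norm.comp (P.continuous.comp (hFb b).continuous))
      filter_upwards [ho.mem_nhds hR0'] with ξ hξ
      rw [hxi' b ξ (le_of_lt hξ)]
    have hchain : HasFDerivAt (fun ξ => Q (F b (xi b (P (F b ξ)))))
        ((fderiv ℝ (fun c => Q (F b (xi b c))) c).comp (P.comp (fderiv ℝ (F b) ξ₀))) ξ₀ := by
      have hgd' : DifferentiableAt ℝ (fun c => Q (F b (xi b c))) (P (F b ξ₀)) := by
        rw [hc0]; exact hgd
      have := hgd'.hasFDerivAt.comp ξ₀ hD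
      rw [hc0] at this
      exact this
    have hED : (fderiv ℝ (fun c => Q (F b (xi b c))) c).comp (P.comp (fderiv ℝ (F b) ξ₀)) =
        Q.comp (fderiv ℝ (F b) ξ₀) :=
      (hEv.hasFDerivAt_iff.mp hchain).unique hDQ
    have hDbij : Function.Bijective (P.comp (fderiv ℝ (F b) ξ₀)) := by
      have := hF6' b ξ₀ hR0'.le
      rwa [hD.fderiv] at this
    have hJ := hF4 b ξ₀
    refine exists_restrictScalars_eq_of_map_mul_I _
      (GraphOfPencil.map_mul_I_of_comp_eq (D' := Q.comp (fderiv ℝ (F b) ξ₀)) hDbij.2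
        (fun ζ => ?_) (fun ζ => ?_) (fun ζ => ?_))
    · rw [← hED]; rfl
    · simp only [ContinuousLinearMap.comp_apply]
      rw [hJ ζ, hJP _ hx]
    · simp only [ContinuousLinearMap.comp_apply]
      rw [hJ ζ, hJQ _ hx]
  /- 4. the graph identity -/
  · show Q (F b (xi b (P (F b ξ)))) = Q (F b ξ)
    rw [hxi' b ξ h]

end Summit.SmoothPoincare4.SmoothPoincare4.Cruxes.TameOrBrodyR4.Sketch
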